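import Literature.Analysis.FluidPDE.SawtoothCascade
import Mathlib.LinearAlgebra.Matrix.Notation
import Mathlib.Analysis.Matrix.Normed

/-!
# K2 lane (route-2 `SawtoothPulseCascade`, crux dir `K1LocalisedCascade`): the explicit 2×2 propagator solves the block ODE (matrix form)

Helper file of the K2 lane (ACL item stmt-AnomalousDissipation-19491), serving planner p4's typed slot map
`Cruxes/K1LocalisedCascade/K2TypedSlotMap.lean`, target `PropagatorODE`: for ANY `2×2` complex matrix `X` with `X² = λ·1` (`λ` real; for the
Kelvin–Helmholtz block `λ = khLam a β = −a²c²(a,β)`, `BlockSq`/`blockX_sq_of`), the explicit propagator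
`P(t) = C(t)·1 + Sn(t)·X`, `(C, Sn) = (cosh √λ t, sinh √λ t/√λ)` (`λ > 0`), `(cos √(−λ) t, sin √(−λ) t/√(−λ))` (`λ < 0`), `(1, t)` (`λ = 0`)
— spelled exactly as p4's `propC`/`propSn` (`if 0 < λ then … else if λ < 0 then … else …`) — satisfies `P(0) = 1` and `P′(t) = X·P(t)`
(`propagator_one_of`, `propagator_hasDerivAt_of`). Matrix twin of the vector statement `sheetPropagator_hasDerivAt` (p679625).
No definitions; no statement about the crux. [cite: Drazin2002, §8.3 (8.36)–(8.38)] [problem: turb]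
-/

-- `Summit.<Summit>.<Problem>`: single-conjunct summit, the duplicate namespace segment is deliberate.
set_option linter.dupNamespace false

noncomputable section

namespace Summit.AnomalousDissipation.AnomalousDissipation.Theorems.SawtoothPulseCascade.K2PhaseBudget

open Set Real Complex Literature.Analysis.FluidPDE.SawtoothCascade

/-! ## §1 `P(0) = 1` -/

/-- `P(0) = C(0)·1 + Sn(0)·X = 1` for p4's three-case `propC`/`propSn` (any `λ`, any `X`). [folklore] -/
theorem propagator_one_of (X : Matrix (Fin 2) (Fin 2) ℂ) (lam : ℝ) :
    ((if 0 < lam then Real.cosh (Real.sqrt lam * 0)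
        else if lam < 0 then Real.cos (Real.sqrt (-lam) * 0) else 1 : ℝ) : ℂ) • (1 : Matrix (Fin 2) (Fin 2) ℂ) +
      ((if 0 < lam then Real.sinh (Real.sqrt lam * 0) / Real.sqrt lam
        else if lam < 0 then Real.sin (Real.sqrt (-lam) * 0) / Real.sqrt (-lam) else 0 : ℝ) : ℂ) • X = 1 := by
  rcases lt_trichotomy lam 0 with h | h | h
  · simp [h]
  · subst h; simp
  · simp [h]

/-! ## §2 `P′ = X P` -/

/-- Scalar-coefficient curves: if `c′ = λ·s(t)` and `s′ = c(t)` at `t` and `X² = λ·1`, then `u ↦ c(u)·1 + s(u)·X` has derivative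
`X·(c(t)·1 + s(t)·X)` at `t`. [folklore] -/
theorem hasDerivAt_scalar_pair_of {X : Matrix (Fin 2) (Fin 2) ℂ} {lam : ℝ}
    (hX : X * X = ((lam : ℝ) : ℂ) • (1 : Matrix (Fin 2) (Fin 2) ℂ)) {c s : ℝ → ℝ} {t : ℝ}
    (hc : HasDerivAt c (lam * s t) t) (hs : HasDerivAt s (c t) t) :
    HasDerivAt (fun u => ((c u : ℝ) : ℂ) • (1 : Matrix (Fin 2) (Fin 2) ℂ) + ((s u : ℝ) : ℂ) • X)
      (X * (((c t : ℝ) : ℂ) • (1 : Matrix (Fin 2) (Fin 2) ℂ) + ((s t : ℝ) : ℂ) • X)) t := by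
  -- the elementwise sup norm (any norm inducing the product topology would do; `HasDerivAt` itself only sees the topology)
  letI : NormedAddCommGroup (Matrix (Fin 2) (Fin 2) ℂ) := Matrix.normedAddCommGroup
  letI : NormedSpace ℝ (Matrix (Fin 2) (Fin 2) ℂ) := Matrix.normedSpace
  letI : NormedSpace ℂ (Matrix (Fin 2) (Fin 2) ℂ) := Matrix.normedSpace
  have h1 := (hc.ofReal_comp).smul_const (1 : Matrix (Fin 2) (Fin 2) ℂ)
  have h2 := (hs.ofReal_comp).smul_const X
  have h := h1.add h2
  refine h.congr_deriv ?_
  rw [Matrix.mul_add, Matrix.mul_smul, Matrix.mul_smul, Matrix.mul_one, hX, smul_smul]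
  push_cast
  rw [add_comm, mul_comm]

/-- **`P′(t) = X·P(t)`** for p4's three-case explicit propagator, given `X² = λ·1`. [cite: Drazin2002, §8.3 (8.36)–(8.38)] -/
theorem propagator_hasDerivAt_of {X : Matrix (Fin 2) (Fin 2) ℂ} {lam : ℝ}
    (hX : X * X = ((lam : ℝ) : ℂ) • (1 : Matrix (Fin 2) (Fin 2) ℂ)) (t : ℝ) :
    HasDerivAt
      (fun u : ℝ =>
        ((if 0 < lam then Real.cosh (Real.sqrt lam * u)
            else if lam < 0 then Real.cos (Real.sqrt (-lam) * u) else 1 : ℝ) : ℂ) • (1 : Matrix (Fin 2) (Fin 2) ℂ) +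
          ((if 0 < lam then Real.sinh (Real.sqrt lam * u) / Real.sqrt lam
            else if lam < 0 then Real.sin (Real.sqrt (-lam) * u) / Real.sqrt (-lam) else u : ℝ) : ℂ) • X)
      (X * (((if 0 < lam then Real.cosh (Real.sqrt lam * t)
            else if lam < 0 then Real.cos (Real.sqrt (-lam) * t) else 1 : ℝ) : ℂ) • (1 : Matrix (Fin 2) (Fin 2) ℂ) +
          ((if 0 < lam then Real.sinh (Real.sqrt lam * t) / Real.sqrt lam
            else if lam < 0 then Real.sin (Real.sqrt (-lam) * t) / Real.sqrt (-lam) else t : ℝ) : ℂ) • X)) t := by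
  rcases lt_trichotomy lam 0 with h | h | h
  · -- stable: `(cos ωt, sin ωt/ω)`, `ω² = −λ`
    have h' : ¬ (0 < lam) := by linarith
    simp only [h, h', if_false, if_true]
    set ω := Real.sqrt (-lam) with hω
    have hω0 : 0 < ω := Real.sqrt_pos.2 (by linarith)
    have hω2 : ω ^ 2 = -lam := by rw [hω, Real.sq_sqrt]; linarith
    have hlw : lam / ω = -ω := by rw [div_eq_iff hω0.ne']; linear_combination hω2
    have hc : HasDerivAt (fun u => Real.cos (ω * u)) (lam * (Real.sin (ω * t) / ω)) t := by
      have := (Real.hasDerivAt_cos (ω * t)).comp t ((hasDerivAt_id t).const_mul ω)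
      refine this.congr_deriv ?_
      calc -Real.sin (ω * t) * (ω * 1) = lam / ω * Real.sin (ω * t) := by rw [hlw]; ring
        _ = lam * (Real.sin (ω * t) / ω) := by ring
    have hs : HasDerivAt (fun u => Real.sin (ω * u) / ω) (Real.cos (ω * t)) t := by
      have := ((Real.hasDerivAt_sin (ω * t)).comp t ((hasDerivAt_id t).const_mul ω)).div_const ω
      refine this.congr_deriv ?_
      field_simp
    exact hasDerivAt_scalar_pair_of hX hc hs
  · -- neutral: `(1, t)`
    subst h
    simp only [lt_irrefl, if_false]
    have hc : HasDerivAt (fun _ : ℝ => (1 : ℝ)) (0 * t) t := by simpa using hasDerivAt_const t (1 : ℝ)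
    have hs : HasDerivAt (fun u : ℝ => u) (1 : ℝ) t := hasDerivAt_id t
    exact hasDerivAt_scalar_pair_of hX hc hs
  · -- unstable: `(cosh rt, sinh rt/r)`, `r² = λ`
    have h' : ¬ (lam < 0) := by linarith
    simp only [h, h', if_false, if_true]
    set r := Real.sqrt lam with hr
    have hr0 : 0 < r := Real.sqrt_pos.2 h
    have hr2 : r ^ 2 = lam := by rw [hr, Real.sq_sqrt h.le]
    have hlr : lam / r = r := by rw [div_eq_iff hr0.ne']; linear_combination -hr2
    have hc : HasDerivAt (fun u => Real.cosh (r * u)) (lam * (Real.sinh (r * t) / r)) t := by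
      have := (Real.hasDerivAt_cosh (r * t)).comp t ((hasDerivAt_id t).const_mul r)
      refine this.congr_deriv ?_
      calc Real.sinh (r * t) * (r * 1) = lam / r * Real.sinh (r * t) := by rw [hlr]; ring
        _ = lam * (Real.sinh (r * t) / r) := by ring
    have hs : HasDerivAt (fun u => Real.sinh (r * u) / r) (Real.cosh (r * t)) t := by
      have := ((Real.hasDerivAt_sinh (r * t)).comp t ((hasDerivAt_id t).const_mul r)).div_const r
      refine this.congr_deriv ?_
      field_simp
    exact hasDerivAt_scalar_pair_of hX hc hs

end Summit.AnomalousDissipation.AnomalousDissipation.Theorems.SawtoothPulseCascade.K2PhaseBudget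

end
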